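import Mathlib
import Summits.NavierStokesRegularity.NavierStokesRegularity.Theorems.LerayQuarterDissipationRecordTimeTypeI
import Summits.NavierStokesRegularity.NavierStokesRegularity.Theses.QuarterLogPincer
import HarnessLib

/-!
# `QuarterLogPincer.RecordTimeTypeI` = `LerayQuarterDissipation.RecordTimeTypeI`
  (item stmt-NavierStokesRegularity-23363, re-wanted verbatim by route `QuarterLogPincer`)

The support `RecordTimeTypeI` of route `QuarterLogPincer` is, character for character, the support
`RecordTimeTypeI` of route `LerayQuarterDissipation` (item stmt-NavierStokesRegularity-22145),
proved in the tree as `Theorems.RecordTimeTypeI.main` (file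
`LerayQuarterDissipationRecordTimeTypeI.lean`): a quarter-rate enstrophy law
`∫|curl u(t)|² ≤ K/√(T−t)` forces the velocity Type-I rate (record-time capacity inequality +
KNSS (4.10) gradient bounds + Sobolev). This file closes the new item by that theorem.

HONEST FRAMING: a conditional criterion about a HYPOTHETICAL blow-up (quarter-rate law ⇒ Type-I
rate); nothing here bears on Navier–Stokes regularity.
-/

noncomputable section

set_option linter.dupNamespace false

namespace Summit.NavierStokesRegularity.NavierStokesRegularity.Theorems

open RecordTimeTypeI in
/-- **Item stmt-NavierStokesRegularity-23363** (`QuarterLogPincer.RecordTimeTypeI`): the quarter-rate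
enstrophy bound forces the velocity Type-I rate, closed by the tree theorem `RecordTimeTypeI.main`.
[cite: KochNadirashviliSereginSverak2009, §4 (4.10); Leray1934, §20] -/
theorem quarterLogPincer_recordTimeTypeI_proof :
    Summit.NavierStokesRegularity.NavierStokesRegularity.Theses.QuarterLogPincer.RecordTimeTypeI := by
  unfold Summit.NavierStokesRegularity.NavierStokesRegularity.Theses.QuarterLogPincer.RecordTimeTypeI
  intro ν T hν hT u p hsol hLH hdec K hK
  exact main hν hT hsol hLH hdec K hK

end Summit.NavierStokesRegularity.NavierStokesRegularity.Theorems

end
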